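import Literature.Analysis.FluidPDE.ForcedOseenRepresentationClassical
import Literature.Analysis.FluidPDE.LpOseenDuhamel
import HarnessLib

/-!
# Energy-weighted sizes of the three terms of the forced Oseen integral equation on `ℝ³`:
# heat term from `L²` data, force term from the `L²` size of the force, and the Duhamel term
# through sup norm AND energy

Analysis/FluidPDE proof file (theorems only; no definitions, no named facts). First half of the
energy-weighted pointwise bound for bounded classical finite-energy solutions of the FORCED
Navier–Stokes system (`ForcedOseenPointwiseEnergyBound.lean`, theorem
`exists_norm_le_of_energy_forced`). The forced Oseen representation
`u(t) = e^{νtΔ}u(0) - B^ν_0(u,u)(t) + ∫₀ᵗ e^{ν(t-τ)Δ} g(τ) dτ` (`ForcedOseenRepresentation(Classical)`)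
has three terms; Leray's sup-norm inequalities (`exists_norm_le_sup_add_sqrt_add_force`) size them by
the sup norms of datum, solution and force. Here they are sized through `L²` quantities:

* `norm_heatExtension_le_of_eLpNorm_two` — `‖(e^{σΔ} f)(x)‖ ≤ ‖f‖₂ σ^{-3/4}` at EVERY point
  (`eLpNorm_top_heatExtension_le_of_Lr`, `r = 2`, plus continuity of the caloric extension);
* `norm_forceDuhamel_le_of_eLpNorm_two` — `‖∫₀ᵗ e^{ν(t-τ)Δ} g(τ) dτ (x)‖ ≤ 4 ν^{-3/4} t^{1/4} G₂` when
  `‖g(τ)‖₂ ≤ G₂` on `(0, t)` (the `L²` twin of `norm_forceDuhamel_le`);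
* `eLpNorm_eight_le_of_bound_of_eLpNorm_two` — the interpolation `‖a‖₈ ≤ M^{3/4} ‖a‖₂^{1/4}` for a
  field bounded by `M`;
* `exists_norm_oseenDuhamel_le_of_energy` — **the Duhamel term through energy and sup norm**:
  `‖B^ν_0(u,u)(t)(x)‖ ≤ C ν^{-7/8} t^{1/8} M^{3/2} E^{1/2}` when `‖u‖ ≤ M` and `‖u(τ)‖₂ ≤ E` on
  `(0, t)`, by Hölder with the Oseen–Koch–Tataru envelope in `L^{8/7}` at every point (Kato's slice
  bound `LpOseen.exists_lintegral_enorm_oseenSlice_le` with `p = 8`: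
  `∫‖K(σ, x−y)[a(y), a(y)]‖dy ≤ C σ^{-7/8} ‖a‖₈²`) and the Beta integral
  `∫₀ᵗ (t-τ)^{-7/8} dτ = 8 t^{1/8}` (`lintegral_Ioo_mul_sub_rpow_neg`);
* the calculus helpers `lintegral_Ioo_zero_comp_sub_left`, `lintegral_Ioo_rpow_neg`,
  `lintegral_Ioo_mul_sub_rpow_neg` (`∫_{(0,t)} (ν(t-τ))^{-e} dτ = ν^{-e} t^{1-e}/(1-e)`, `e < 1`).

The point: the Duhamel term is of order `M^{3/2} E^{1/2}` — SMALL for a field of small energy and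
merely bounded sup norm, uniformly on a time window of fixed length — where Leray's bound
(`exists_norm_oseenDuhamel_bounded_le`, `∝ M² √t`) is not. Mechanism: Leray 1934 §19–§21 with the
`Lᵖ` sizes of the Oseen kernel of Kato 1984, (2.3)–(2.4′) / Lemarié-Rieusset 2016, Prop. 6.4 (6.10)
and proof of Thm. 7.5, in place of the `L¹` size.

Cell `ns-blowup` labels: LABEL Literature port (sizes of the terms of an integral equation for GIVEN
fields); bears_on LADDER-NS N1 (route-NavierStokesRegularity-PalasekTowerBreakdown, crux
stmt-NavierStokesRegularity-19179 `EpisodeBase`, negative lane of the ∀-placeholder `FirstEpisodeR`);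
WHAT THIS IS NOT: not NS — nothing about regularity or blow-up is asserted.

## Mathlib / tree search

Tree: `forceDuhamel_apply` (`ForcedOseenRepresentation`); `oseenDuhamel_apply`
(`NSBoundedMildOseen`); `LpOseen.exists_lintegral_enorm_oseenSlice_le` (`LpOseenDuhamel`);
`eLpNorm_top_heatExtension_le_of_Lr`, `forall_norm_le_of_ae_norm_le` (`NSLerayBlowupRateLpProofs`);
`UnboundedOperators.contDiff_heatExtension_holds`. The sup-norm twins are `norm_forceDuhamel_le`,
`exists_norm_oseenDuhamel_bounded_le`, `exists_enorm_oseenDuhamel_weighted_le`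
(`lean search 'forceDuhamel_le|oseenDuhamel_le_of_energy|eLpNorm_eight'`: no energy-weighted
versions existed; a reflection helper `lintegral_Ioo_comp_sub_left` exists only inside a `Summits`
file, not importable here). Mathlib: `enorm_integral_le_lintegral_enorm`, `setLIntegral_mono'`,
`lintegral_mul_const'`, `lintegral_const_mul'`, `integral_rpow`, `lintegral_sub_left_eq_self`,
`ENNReal.rpow_le_rpow`, `ae_le_eLpNormEssSup`.

## References

* J. Leray, Acta Math. 63 (1934), §19 (3.4)–(3.8), §21 (3.5). [Leray1934]
* T. Kato, Math. Z. 187 (1984) 471–480, §2, (2.3)–(2.4′). [Kato1984]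
* P. G. Lemarié-Rieusset, *The Navier–Stokes Problem in the 21st Century*, CRC Press (2016),
  Prop. 6.4 (6.10), Thm. 6.1 (6.12), Thm. 7.5 (proof, PDF pp. 155–158). [LemarieRieusset2016]
* W. S. Ożański, B. C. Pooley, LMS Lecture Note Ser. 452 (2018) = arXiv:1708.09787, (6.65) with
  Lemma 6.9 (i). [OzanskiPooley2018]
-/

noncomputable section

open MeasureTheory TopologicalSpace Set Function Filter
open _root_.Topology
open scoped InnerProductSpace RealInnerProductSpace ENNReal NNReal

namespace Literature.Analysis.FluidPDE

/-! ### Calculus: the Beta-type time integrals `∫_{(0,t)} (ν(t-τ))^{-e} dτ` -/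

section Calculus

/-- Reflection `τ ↦ t − τ` maps `(0, t)` onto itself: `∫_{(0,t)} g(t − τ) dτ = ∫_{(0,t)} g(σ) dσ`
(lower Lebesgue integrals). [folklore] -/
private theorem lintegral_Ioo_zero_comp_sub_left (g : ℝ → ℝ≥0∞) (t : ℝ) :
    ∫⁻ τ in Ioo 0 t, g (t - τ) = ∫⁻ σ in Ioo 0 t, g σ := by
  rw [← lintegral_indicator measurableSet_Ioo, ← lintegral_indicator measurableSet_Ioo]
  have h : (fun τ => (Ioo 0 t).indicator (fun τ => g (t - τ)) τ) =
      fun τ => (Ioo 0 t).indicator g (t - τ) := by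
    funext τ
    simp only [Set.indicator_apply, mem_Ioo]
    by_cases h1 : 0 < τ ∧ τ < t
    · rw [if_pos h1, if_pos ⟨by linarith [h1.2], by linarith [h1.1]⟩]
    · rw [if_neg h1, if_neg (fun h2 => h1 ⟨by linarith [h2.2], by linarith [h2.1]⟩)]
  rw [h, lintegral_sub_left_eq_self (fun s => (Ioo 0 t).indicator g s) t]

/-- `∫_{(0,t)} σ^{-e} dσ = t^{1-e} / (1 - e)` in `ℝ≥0∞`, for `e < 1`, `0 < t`. [folklore] -/
private theorem lintegral_Ioo_rpow_neg {e t : ℝ} (he1 : e < 1) (ht : 0 < t) :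
    ∫⁻ σ in Ioo 0 t, ENNReal.ofReal (σ ^ (-e)) = ENNReal.ofReal (t ^ (1 - e) / (1 - e)) := by
  have hr : (-1 : ℝ) < -e := by linarith
  have hii : IntervalIntegrable (fun σ : ℝ => σ ^ (-e)) volume 0 t :=
    intervalIntegral.intervalIntegrable_rpow' hr
  have hint : IntegrableOn (fun σ : ℝ => σ ^ (-e)) (Ioo 0 t) :=
    (hii.1).mono_set Ioo_subset_Ioc_self
  have hnn : 0 ≤ᵐ[volume.restrict (Ioo 0 t)] fun σ : ℝ => σ ^ (-e) :=
    (ae_restrict_mem measurableSet_Ioo).mono fun σ hσ => Real.rpow_nonneg hσ.1.le _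
  rw [← ofReal_integral_eq_lintegral_ofReal hint hnn, ← integral_Ioc_eq_integral_Ioo,
    ← intervalIntegral.integral_of_le ht.le, integral_rpow (Or.inl hr)]
  congr 1
  have h1 : -e + 1 = 1 - e := by ring
  rw [h1, Real.zero_rpow (by linarith), sub_zero]

/-- `∫_{(0,t)} (ν(t − τ))^{-e} dτ = ν^{-e} t^{1-e} / (1 - e)` in `ℝ≥0∞`, for `e < 1`, `0 < t`,
`0 < ν`. [folklore] -/
private theorem lintegral_Ioo_mul_sub_rpow_neg {ν e t : ℝ} (hν : 0 < ν) (he1 : e < 1) (ht : 0 < t) :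
    ∫⁻ τ in Ioo 0 t, ENNReal.ofReal ((ν * (t - τ)) ^ (-e)) =
      ENNReal.ofReal (ν ^ (-e) * (t ^ (1 - e) / (1 - e))) := by
  rw [lintegral_Ioo_zero_comp_sub_left (fun σ => ENNReal.ofReal ((ν * σ) ^ (-e))) t]
  calc ∫⁻ σ in Ioo 0 t, ENNReal.ofReal ((ν * σ) ^ (-e))
      = ∫⁻ σ in Ioo 0 t, ENNReal.ofReal (ν ^ (-e)) * ENNReal.ofReal (σ ^ (-e)) := by
        refine setLIntegral_congr_fun measurableSet_Ioo fun σ hσ => ?_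
        rw [Real.mul_rpow hν.le hσ.1.le, ENNReal.ofReal_mul (Real.rpow_nonneg hν.le _)]
    _ = ENNReal.ofReal (ν ^ (-e)) * ENNReal.ofReal (t ^ (1 - e) / (1 - e)) := by
        rw [lintegral_const_mul' _ _ ENNReal.ofReal_ne_top, lintegral_Ioo_rpow_neg he1 ht]
    _ = ENNReal.ofReal (ν ^ (-e) * (t ^ (1 - e) / (1 - e))) := by
        rw [← ENNReal.ofReal_mul (Real.rpow_nonneg hν.le _)]

end Calculus

/-! ### The heat flow from `L²` data, pointwise -/

section Heat

/-- **`L² → L^∞` for the heat flow on `ℝ³`, at EVERY point**: if `f ∈ L²` with `‖f‖₂ ≤ N` then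
`‖(e^{σΔ} f)(x)‖ ≤ N σ^{-3/4}` for `σ > 0` and all `x` (`eLpNorm_top_heatExtension_le_of_Lr` with
`r = 2`, and continuity of the caloric extension). [cite: OzanskiPooley2018, (6.65) p. 143] -/
theorem norm_heatExtension_le_of_eLpNorm_two
    {f : EuclideanSpace ℝ (Fin 3) → EuclideanSpace ℝ (Fin 3)} (hf : MemLp f 2 volume) {N σ : ℝ}
    (hN : 0 ≤ N) (hfN : eLpNorm f 2 volume ≤ ENNReal.ofReal N) (hσ : 0 < σ)
    (x : EuclideanSpace ℝ (Fin 3)) :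
    ‖UnboundedOperators.heatExtension f σ x‖ ≤ N * σ ^ (-(3 / 4 : ℝ)) := by
  have hfN' : eLpNorm f (ENNReal.ofReal 2) volume ≤ ENNReal.ofReal N := by
    rwa [ENNReal.ofReal_ofNat]
  have h := eLpNorm_top_heatExtension_le_of_Lr hf.1 (r := 2) (by norm_num) hN hfN' hσ
  have hexp : -(3 / (2 * (2 : ℝ))) = -(3 / 4 : ℝ) := by norm_num
  rw [hexp, eLpNorm_exponent_top] at h
  have hcont : Continuous (UnboundedOperators.heatExtension f σ) :=
    (UnboundedOperators.contDiff_heatExtension_holds hf (by norm_num) hσ).continuous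
  have hb0 : 0 ≤ N * σ ^ (-(3 / 4 : ℝ)) := mul_nonneg hN (Real.rpow_nonneg hσ.le _)
  have hae : ∀ᵐ y ∂(volume : Measure (EuclideanSpace ℝ (Fin 3))),
      ‖UnboundedOperators.heatExtension f σ y‖ ≤ N * σ ^ (-(3 / 4 : ℝ)) := by
    filter_upwards [ae_le_eLpNormEssSup (f := UnboundedOperators.heatExtension f σ)
      (μ := (volume : Measure (EuclideanSpace ℝ (Fin 3))))] with y hy
    have := hy.trans h
    rwa [← ofReal_norm, ENNReal.ofReal_le_ofReal_iff hb0] at this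
  exact forall_norm_le_of_ae_norm_le hcont hae x

end Heat

/-! ### The interpolation `‖a‖₈ ≤ M^{3/4} ‖a‖₂^{1/4}` -/

section Interpolation

/-- **`L⁸` from `L²` and `L^∞`**: if `‖a(y)‖ ≤ M` everywhere and `‖a‖₂ ≤ E`, then
`‖a‖₈ ≤ M^{3/4} E^{1/4}` (`∫|a|⁸ ≤ M⁶ ∫|a|²`). [folklore] -/
private theorem eLpNorm_eight_le_of_bound_of_eLpNorm_two
    {a : EuclideanSpace ℝ (Fin 3) → EuclideanSpace ℝ (Fin 3)} {M E : ℝ} (hM : 0 ≤ M) (hE : 0 ≤ E)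
    (hbd : ∀ y, ‖a y‖ ≤ M) (h2 : eLpNorm a 2 volume ≤ ENNReal.ofReal E) :
    eLpNorm a 8 volume ≤ ENNReal.ofReal (M ^ (3 / 4 : ℝ) * E ^ (1 / 4 : ℝ)) := by
  -- the squared `L²` size
  have h2' : ∫⁻ y, ‖a y‖ₑ ^ (2 : ℝ) ≤ ENNReal.ofReal E ^ (2 : ℝ) := by
    rw [eLpNorm_eq_lintegral_rpow_enorm_toReal two_ne_zero ENNReal.ofNat_ne_top,
      ENNReal.toReal_ofNat] at h2
    have h := ENNReal.rpow_le_rpow h2 (z := 2) (by norm_num)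
    rwa [← ENNReal.rpow_mul, show (1 / (2 : ℝ)) * 2 = 1 by norm_num, ENNReal.rpow_one] at h
  -- pointwise `‖a‖⁸ ≤ M⁶ ‖a‖²`
  have hpt : ∀ y, ‖a y‖ₑ ^ (8 : ℝ) ≤ ENNReal.ofReal M ^ (6 : ℝ) * ‖a y‖ₑ ^ (2 : ℝ) := by
    intro y
    have h6 : ‖a y‖ₑ ^ (6 : ℝ) ≤ ENNReal.ofReal M ^ (6 : ℝ) := by
      refine ENNReal.rpow_le_rpow ?_ (by norm_num)
      rw [← ofReal_norm]
      exact ENNReal.ofReal_le_ofReal (hbd y)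
    calc ‖a y‖ₑ ^ (8 : ℝ) = ‖a y‖ₑ ^ (6 : ℝ) * ‖a y‖ₑ ^ (2 : ℝ) := by
          rw [← ENNReal.rpow_add_of_nonneg _ _ (by norm_num) (by norm_num)]; norm_num
      _ ≤ ENNReal.ofReal M ^ (6 : ℝ) * ‖a y‖ₑ ^ (2 : ℝ) := mul_le_mul' h6 le_rfl
  have h8 : ∫⁻ y, ‖a y‖ₑ ^ (8 : ℝ) ≤ ENNReal.ofReal M ^ (6 : ℝ) * ENNReal.ofReal E ^ (2 : ℝ) :=
    calc ∫⁻ y, ‖a y‖ₑ ^ (8 : ℝ) ≤ ∫⁻ y, ENNReal.ofReal M ^ (6 : ℝ) * ‖a y‖ₑ ^ (2 : ℝ) :=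
          lintegral_mono hpt
      _ = ENNReal.ofReal M ^ (6 : ℝ) * ∫⁻ y, ‖a y‖ₑ ^ (2 : ℝ) :=
          lintegral_const_mul' _ _ (ENNReal.rpow_ne_top_of_nonneg (by norm_num) ENNReal.ofReal_ne_top)
      _ ≤ ENNReal.ofReal M ^ (6 : ℝ) * ENNReal.ofReal E ^ (2 : ℝ) := mul_le_mul' le_rfl h2'
  rw [eLpNorm_eq_lintegral_rpow_enorm_toReal (by norm_num) ENNReal.ofNat_ne_top,
    show (8 : ℝ≥0∞).toReal = 8 by norm_num]
  calc (∫⁻ y, ‖a y‖ₑ ^ (8 : ℝ)) ^ (1 / (8 : ℝ))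
      ≤ (ENNReal.ofReal M ^ (6 : ℝ) * ENNReal.ofReal E ^ (2 : ℝ)) ^ (1 / (8 : ℝ)) :=
        ENNReal.rpow_le_rpow h8 (by norm_num)
    _ = ENNReal.ofReal (M ^ (3 / 4 : ℝ) * E ^ (1 / 4 : ℝ)) := by
        rw [ENNReal.mul_rpow_of_nonneg _ _ (by norm_num), ← ENNReal.rpow_mul, ← ENNReal.rpow_mul,
          ENNReal.ofReal_rpow_of_nonneg hM (by norm_num), ENNReal.ofReal_rpow_of_nonneg hE (by norm_num),
          ← ENNReal.ofReal_mul (Real.rpow_nonneg hM _)]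
        norm_num

end Interpolation

/-! ### The force term through the `L²` size of the force -/

section Force

/-- **The heat Duhamel integral of an `L²`-bounded force, pointwise**: if `g(τ) ∈ L²` with
`‖g(τ)‖₂ ≤ G₂` on `(0, t)`, then `‖forceDuhamel ν 0 g t x‖ ≤ 4 ν^{-3/4} t^{1/4} G₂` for every `x`
(`‖e^{ν(t-τ)Δ} g(τ)‖_∞ ≤ (ν(t-τ))^{-3/4} ‖g(τ)‖₂` under the time integral). The `L²` twin of
`norm_forceDuhamel_le`. [cite: LemarieRieusset2016, Thm. 6.1 (6.12) with Prop. 6.4 (6.10)] -/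
theorem norm_forceDuhamel_le_of_eLpNorm_two {ν t G₂ : ℝ}
    {g : ℝ → EuclideanSpace ℝ (Fin 3) → EuclideanSpace ℝ (Fin 3)} (hν : 0 < ν) (ht : 0 < t)
    (hG₂ : 0 ≤ G₂) (hgm : ∀ τ ∈ Ioo 0 t, MemLp (g τ) 2 volume)
    (hg2 : ∀ τ ∈ Ioo 0 t, eLpNorm (g τ) 2 volume ≤ ENNReal.ofReal G₂)
    (x : EuclideanSpace ℝ (Fin 3)) :
    ‖forceDuhamel ν 0 g t x‖ ≤ 4 * ν ^ (-(3 / 4 : ℝ)) * t ^ (1 / 4 : ℝ) * G₂ := by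
  rw [forceDuhamel_apply]
  have hb0 : 0 ≤ 4 * ν ^ (-(3 / 4 : ℝ)) * t ^ (1 / 4 : ℝ) * G₂ := by positivity
  have hpt : ∀ τ ∈ Ioo 0 t, ‖UnboundedOperators.heatExtension (g τ) (ν * (t - τ)) x‖ₑ ≤
      ENNReal.ofReal ((ν * (t - τ)) ^ (-(3 / 4 : ℝ))) * ENNReal.ofReal G₂ := by
    intro τ hτ
    have hσ : 0 < ν * (t - τ) := mul_pos hν (sub_pos.2 hτ.2)
    have h := norm_heatExtension_le_of_eLpNorm_two (hgm τ hτ) hG₂ (hg2 τ hτ) hσ x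
    rw [← ofReal_norm, ← ENNReal.ofReal_mul (Real.rpow_nonneg hσ.le _)]
    exact ENNReal.ofReal_le_ofReal (h.trans (le_of_eq (mul_comm _ _)))
  have h1 : ‖∫ τ in Ioo 0 t, UnboundedOperators.heatExtension (g τ) (ν * (t - τ)) x‖ₑ ≤
      ENNReal.ofReal (4 * ν ^ (-(3 / 4 : ℝ)) * t ^ (1 / 4 : ℝ) * G₂) := by
    calc ‖∫ τ in Ioo 0 t, UnboundedOperators.heatExtension (g τ) (ν * (t - τ)) x‖ₑ
        ≤ ∫⁻ τ in Ioo 0 t, ‖UnboundedOperators.heatExtension (g τ) (ν * (t - τ)) x‖ₑ :=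
          enorm_integral_le_lintegral_enorm _
      _ ≤ ∫⁻ τ in Ioo 0 t, ENNReal.ofReal ((ν * (t - τ)) ^ (-(3 / 4 : ℝ))) * ENNReal.ofReal G₂ :=
          setLIntegral_mono' measurableSet_Ioo fun τ hτ => hpt τ hτ
      _ = (∫⁻ τ in Ioo 0 t, ENNReal.ofReal ((ν * (t - τ)) ^ (-(3 / 4 : ℝ)))) * ENNReal.ofReal G₂ :=
          lintegral_mul_const' _ _ ENNReal.ofReal_ne_top
      _ = ENNReal.ofReal (ν ^ (-(3 / 4 : ℝ)) * (t ^ (1 - 3 / 4 : ℝ) / (1 - 3 / 4))) *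
            ENNReal.ofReal G₂ := by
          rw [lintegral_Ioo_mul_sub_rpow_neg hν (by norm_num) ht]
      _ = ENNReal.ofReal (4 * ν ^ (-(3 / 4 : ℝ)) * t ^ (1 / 4 : ℝ) * G₂) := by
          rw [← ENNReal.ofReal_mul (by positivity)]
          congr 1
          rw [show (1 - 3 / 4 : ℝ) = 1 / 4 by norm_num]
          ring
  rw [← ofReal_norm, ENNReal.ofReal_le_ofReal_iff hb0] at h1
  exact h1

end Force

/-! ### The nonlinear term through energy and sup norm -/

section Nonlinear

/-- **The Duhamel term of a bounded field of small energy is small**: there is a universal `C > 0`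
such that for `ν > 0`, `t > 0`, and a field `u` with measurable slices, `‖u(τ, ·)‖ ≤ M` and
`‖u(τ)‖₂ ≤ E` on `(0, t)`, `‖B^ν_0(u,u)(t)(x)‖ ≤ C ν^{-7/8} t^{1/8} M^{3/2} E^{1/2}` for every `x`
(Kato's slice bound `∫‖K(σ, x−y)[a, a]‖dy ≤ C σ^{-7/8} ‖a‖₈²`, the interpolation
`‖a‖₈² ≤ M^{3/2} ‖a‖₂^{1/2}`, and `∫₀ᵗ (t-τ)^{-7/8} dτ = 8 t^{1/8}`).
[cite: Kato1984, (2.3)–(2.4')] [cite: LemarieRieusset2016, Prop. 6.4 (6.10)] -/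
theorem exists_norm_oseenDuhamel_le_of_energy :
    ∃ C : ℝ, 0 < C ∧ ∀ {ν t M E : ℝ}
      {u : ℝ → EuclideanSpace ℝ (Fin 3) → EuclideanSpace ℝ (Fin 3)},
      0 < ν → 0 < t → 0 ≤ M → 0 ≤ E →
      (∀ τ ∈ Ioo 0 t, AEStronglyMeasurable (u τ) volume) →
      (∀ τ ∈ Ioo 0 t, ∀ y, ‖u τ y‖ ≤ M) →
      (∀ τ ∈ Ioo 0 t, eLpNorm (u τ) 2 volume ≤ ENNReal.ofReal E) →
      ∀ x, ‖oseenDuhamel ν 0 u u t x‖ ≤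
        C * ν ^ (-(7 / 8 : ℝ)) * t ^ (1 / 8 : ℝ) * (M ^ (3 / 2 : ℝ) * E ^ (1 / 2 : ℝ)) := by
  obtain ⟨C₀, hC₀, hS⟩ := LpOseen.exists_lintegral_enorm_oseenSlice_le
    (p := (8 : ℝ≥0∞)) (by norm_num)
  refine ⟨8 * (C₀ + 1), by positivity, ?_⟩
  intro ν t M E u hν ht hM hE hsl hbd h2 x
  have h8toReal : (8 : ℝ≥0∞).toReal = 8 := by norm_num
  -- the `L⁸` size of the slices
  have hL8 : ∀ τ ∈ Ioo 0 t,
      eLpNorm (u τ) 8 volume ≤ ENNReal.ofReal (M ^ (3 / 4 : ℝ) * E ^ (1 / 4 : ℝ)) :=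
    fun τ hτ => eLpNorm_eight_le_of_bound_of_eLpNorm_two hM hE (hbd τ hτ) (h2 τ hτ)
  set K : ℝ := M ^ (3 / 2 : ℝ) * E ^ (1 / 2 : ℝ) with hK
  have hK0 : 0 ≤ K := by positivity
  have hKsq : ENNReal.ofReal (M ^ (3 / 4 : ℝ) * E ^ (1 / 4 : ℝ)) *
      ENNReal.ofReal (M ^ (3 / 4 : ℝ) * E ^ (1 / 4 : ℝ)) = ENNReal.ofReal K := by
    rw [← ENNReal.ofReal_mul (by positivity)]
    congr 1
    rw [hK, mul_mul_mul_comm, ← Real.rpow_add' hM (by norm_num), ← Real.rpow_add' hE (by norm_num)]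
    norm_num
  -- the slices, pointwise
  have hslice : ∀ τ ∈ Ioo 0 t,
      ‖∫ y, oseenKernel (ν * (t - τ)) (x - y) (u τ y) (u τ y)‖ₑ ≤
        ENNReal.ofReal ((C₀ + 1) * K) * ENNReal.ofReal ((ν * (t - τ)) ^ (-(7 / 8 : ℝ))) := by
    intro τ hτ
    have hσ : 0 < ν * (t - τ) := mul_pos hν (sub_pos.2 hτ.2)
    have h := hS hσ (hsl τ hτ) (hsl τ hτ) x
    have hexp : -(1 / 2 + 3 / (8 : ℝ≥0∞).toReal) = -(7 / 8 : ℝ) := by rw [h8toReal]; norm_num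
    rw [hexp] at h
    calc ‖∫ y, oseenKernel (ν * (t - τ)) (x - y) (u τ y) (u τ y)‖ₑ
        ≤ ∫⁻ y, ‖oseenKernel (ν * (t - τ)) (x - y) (u τ y) (u τ y)‖ₑ :=
          enorm_integral_le_lintegral_enorm _
      _ ≤ ENNReal.ofReal (C₀ * (ν * (t - τ)) ^ (-(7 / 8 : ℝ))) *
            (eLpNorm (u τ) 8 volume * eLpNorm (u τ) 8 volume) := h
      _ ≤ ENNReal.ofReal ((C₀ + 1) * (ν * (t - τ)) ^ (-(7 / 8 : ℝ))) * ENNReal.ofReal K := by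
          refine mul_le_mul' (ENNReal.ofReal_le_ofReal ?_) ?_
          · exact mul_le_mul_of_nonneg_right (by linarith) (Real.rpow_nonneg hσ.le _)
          · rw [← hKsq]; exact mul_le_mul' (hL8 τ hτ) (hL8 τ hτ)
      _ = ENNReal.ofReal ((C₀ + 1) * K) * ENNReal.ofReal ((ν * (t - τ)) ^ (-(7 / 8 : ℝ))) := by
          rw [← ENNReal.ofReal_mul (by positivity), ← ENNReal.ofReal_mul (by positivity)]
          ring_nf
  have hb0 : 0 ≤ 8 * (C₀ + 1) * ν ^ (-(7 / 8 : ℝ)) * t ^ (1 / 8 : ℝ) * K := by positivity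
  have h1 : ‖oseenDuhamel ν 0 u u t x‖ₑ ≤
      ENNReal.ofReal (8 * (C₀ + 1) * ν ^ (-(7 / 8 : ℝ)) * t ^ (1 / 8 : ℝ) * K) := by
    rw [oseenDuhamel_apply]
    calc ‖∫ τ in Ioo 0 t, ∫ y, oseenKernel (ν * (t - τ)) (x - y) (u τ y) (u τ y)‖ₑ
        ≤ ∫⁻ τ in Ioo 0 t, ‖∫ y, oseenKernel (ν * (t - τ)) (x - y) (u τ y) (u τ y)‖ₑ :=
          enorm_integral_le_lintegral_enorm _
      _ ≤ ∫⁻ τ in Ioo 0 t, ENNReal.ofReal ((C₀ + 1) * K) *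
            ENNReal.ofReal ((ν * (t - τ)) ^ (-(7 / 8 : ℝ))) :=
          setLIntegral_mono' measurableSet_Ioo hslice
      _ = ENNReal.ofReal ((C₀ + 1) * K) *
            ∫⁻ τ in Ioo 0 t, ENNReal.ofReal ((ν * (t - τ)) ^ (-(7 / 8 : ℝ))) :=
          lintegral_const_mul' _ _ ENNReal.ofReal_ne_top
      _ = ENNReal.ofReal ((C₀ + 1) * K) *
            ENNReal.ofReal (ν ^ (-(7 / 8 : ℝ)) * (t ^ (1 - 7 / 8 : ℝ) / (1 - 7 / 8))) := by
          rw [lintegral_Ioo_mul_sub_rpow_neg hν (by norm_num) ht]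
      _ = ENNReal.ofReal (8 * (C₀ + 1) * ν ^ (-(7 / 8 : ℝ)) * t ^ (1 / 8 : ℝ) * K) := by
          rw [← ENNReal.ofReal_mul (by positivity)]
          congr 1
          rw [show (1 - 7 / 8 : ℝ) = 1 / 8 by norm_num]
          ring
  rw [← ofReal_norm, ENNReal.ofReal_le_ofReal_iff hb0] at h1
  exact h1

end Nonlinear

end Literature.Analysis.FluidPDE

end
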